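import Summits.BirchSwinnertonDyer.BirchSwinnertonDyer.Theorems.ManinLocalTwoThreeShimuraFiveCoverKernel
import Summits.BirchSwinnertonDyer.Rank1Residual.ManinAdditive.ShimuraCoverMuThreeSplit
import Summits.BirchSwinnertonDyer.BirchSwinnertonDyer.Theorems.ManinLocalTwoThreeShimuraPrimeLevelAtTwo
import Summits.BirchSwinnertonDyer.BirchSwinnertonDyer.Theorems.ManinLocalTwoThreeStevensCuspRationalHolds
import Literature.NumberTheory.EllipticCurves.TorsionFrobeniusProofs
import Literature.NumberTheory.EllipticCurves.FrobeniusEndomorphism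
import Literature.NumberTheory.EllipticCurves.ModPReducibility
import Literature.NumberTheory.Automorphic.AshSmithTheoryHeckeProofs
import HarnessLib

/-!
# `5 ∣ [Λ₀(f) : Λ₁(f)]` forces `11 ∣ N` — part 3/3: reduction at `11`, assembly, prime-level Derickx–Orlić law (es g43, road β; MEMO-es §65, row E-es-221)

Route `ManinLocalTwoThree`, crux C2 `ManinOddAtFour` stmt-BirchSwinnertonDyer-22967 (helper; also feeds R5♯ =
`EsG42.ShimuraNoFiveTorsionOfFiveAtTwo` and completes the prime-level law of `Theorems/ManinLocalTwoThreeShimuraPrimeLevelAtTwo.lean`).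

THEOREM (unconditional, `eleven_dvd_level_of_not_shimuraIndexPrimeTo_five`).  Let `W₀/ℚ` be a globally minimal elliptic curve
with a LATTICE-OPTIMAL `X₀(N)`-datum `D₀` (`Λ(D₀.L) = c₀·Λ₀(f)`).  If the Shimura-cover kernel `Λ₀(f)/Λ₁(f)` has an element of
order `5` (`¬ ShimuraIndexPrimeTo 5 f`), then `11 ∣ N`.

PROOF.  (1) The flat Stevens twin `D₁` (`CuspValues.exists_optimal_gamma1ParametrizationData_flat_of_datum`) with F★
(`CuspValues.optimalGamma1Parametrization_cusp_rational_holds`) makes the kernel of the Shimura cover `W₁ → W₀` rational and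
yields a rational `P ∈ W₁(ℚ)` of order `5` in it (`ShimuraCover.exists_addOrderOf_eq_of_mem_periodLattice`); cusp lifting
(`CuspLifting.exists_addOrderOf_eq_prime`) yields a rational `t ∈ W₀(ℚ)` of order `5`.  (2) THEOREM A (part 2/3): every
`σ ∈ Γ_ℚ` fixing `μ₅` acts trivially on `W₀[5]`.  (3) LEMMA R (`sq_dvd_reductionPointCount_of_frobenius_smul_eq`): if an
arithmetic Frobenius at a good prime `ℓ ≠ p` acts trivially on `W[p]`, reduction mod `ℓ` (injective on `W[p^∞]`,
Frobenius-equivariant: `exists_reduceTorsionHom`) embeds `W[p] ≅ (ℤ/p)²` into `W̃(𝔽_ℓ)` (`mem_range_toGeomPoints_of_smul_eq`),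
so `p² ∣ #W̃(𝔽_ℓ)`.  (4) THEOREM B (`not_hasGoodReductionAtPrime_eleven_of_smul_eq`): `Frob₁₁` fixes `μ₅` (`11 ≡ 1 (mod 5)`,
`smul_eq_pow_residueCard_of_isArithFrobAt`), so good reduction at `11` would give `25 ∣ #W̃₀(𝔽₁₁) = 12 − a₁₁ ∈ [6, 18]`
(Hasse, `frobeniusTrace_sq_le_four_mul`) — impossible; hence `11 ∣ N_W₀ ∣ N`-wise `11 ∣ N` (Carayol,
`IsNewformOf.dvd_level_iff_dvd_conductorNorm`).

COROLLARIES.  `shimuraIndexPrimeTo_five_of_not_eleven_dvd`; `periodLattice_le_gamma1_of_frobeniusTrace_two_eq_neg_two` (odd level,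
`11 ∤ N`, `a₂ = −2 ⟹ Λ₀(f) = Λ₁(f)`, via `ShimuraIndexAtTwo.oddLevelEisensteinAtTwo`: `5Λ₀ ⊆ Λ₁`); and THE DERICKX–ORLIĆ EXPONENT
LAW AT EVERY PRIME LEVEL `q ∉ {11, 17}` (`two_mul_mem_or_three_mul_mem_primeLevel_of_ne`: `2Λ₀(f) ⊆ Λ₁(f) ∨ 3Λ₀(f) ⊆ Λ₁(f)`),
removing the residue `q ≡ 1 (mod 5)` of `ShimuraPrimeLevelAtTwo.two_mul_mem_or_three_mul_mem_primeLevel`; both excluded levels are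
genuine exceptions (11a1: `Λ₀/Λ₁ ≅ ℤ/5`; 17a1: `ℤ/4`; census HOME/es/E15-LATTICE-INDEX-v1.tsv: `5 ∣ [Λ₀:Λ₁]` at exactly 1 of
1025 classes, 11a1).

HONEST FRAMING: unconditional tree theorems (standard axioms); no definitions, no named facts, no sorry.  C2 `ManinOddAtFour`, C3, the
Derickx–Orlić question at composite level, Manin's conjecture and BSD are NOT proved by this file.
[cite: Vatsal2005, Rem. 1.8] [cite: LingOesterle1991, §1 Cor. 1, Thm. 1, Thm. 6] [cite: Stevens1989, §2] [cite: Manin1972, Thm. 1.9]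
[cite: SilvermanAEC2009, III.8.1, V.1.1, VII.3.1(b), VII.5.1(a)] [cite: DerickxOrlic2025, Rmk. 4.8] [cite: Carayol1986, Thm. (A)]
[cite: Setzer1975, Thm. 2]
-/

set_option linter.dupNamespace false
set_option autoImplicit false

noncomputable section

open scoped Classical MatrixGroups ModularForm PeriodPair

open CongruenceSubgroup WeierstrassCurve Field Polynomial NumberField IsDedekindDomain IsDedekindDomain.HeightOneSpectrum
  Literature.NumberTheory.EllipticCurves
  Literature.NumberTheory.EllipticCurves.ModularForms Summit.BirchSwinnertonDyer.Rank1Residual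
  Summit.BirchSwinnertonDyer.Rank1Residual.ManinAdditive Summit.BirchSwinnertonDyer.Rank1Residual.ManinAdditive.KatoCurve
  Summit.BirchSwinnertonDyer.Rank1Residual.ManinAdditive.ShimuraCover
  Summit.BirchSwinnertonDyer.BirchSwinnertonDyer.Theorems.ManinLocalTwoThree
  Summit.BirchSwinnertonDyer.BirchSwinnertonDyer.Theorems.ManinLocalTwoThree.CuspGalois
  Summit.BirchSwinnertonDyer.BirchSwinnertonDyer.Theorems.ManinLocalTwoThree.ShimuraCoverHolds

namespace Summit.BirchSwinnertonDyer.BirchSwinnertonDyer.Theorems.ManinLocalTwoThree.ShimuraFive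

/-! ### §3. LEMMA R — a Frobenius acting trivially on `W[p]` forces `p² ∣ #W̃(𝔽_ℓ)` -/

/-- **LEMMA R.**  `W/ℚ` globally minimal, `ℓ ≠ p` primes, `W` good at `ℓ`, `v` the place over `ℓ`.  If every arithmetic
Frobenius at every prime of `\bar ℤ` over `v` acts trivially on `W[p]`, then `p² ∣ #W̃(𝔽_ℓ)`: the reduction map is injective on
`W[p^∞]` and Frobenius-equivariant (`exists_reduceTorsionHom`), so `W[p] ≅ (ℤ/p)²` lands in the `Frob_ℓ`-fixed points
`W̃(𝔽_ℓ)` (`mem_range_toGeomPoints_of_smul_eq`). [cite: SilvermanAEC2009, VII.3.1(b), III.6.4(b), V.1.1] -/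
theorem sq_dvd_reductionPointCount_of_frobenius_smul_eq (W : WeierstrassCurve ℚ) [W.IsElliptic]
    [W.IsGloballyMinimal] {p ℓ : ℕ} [Fact p.Prime] [Fact ℓ.Prime] (hℓp : ℓ ≠ p)
    (hgoodℓ : W.HasGoodReductionAtPrime ℓ) {v : HeightOneSpectrum (𝓞 ℚ)}
    (hvℓ : (Rat.HeightOneSpectrum.primesEquiv v : ℕ) = ℓ)
    (hfix : ∀ 𝔓 ∈ v.primesAbove, ∀ φ : Field.absoluteGaloisGroup ℚ, IsArithFrobAt (𝓞 ℚ) φ 𝔓 →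
      ∀ T : W.geomTorsion p, φ • T = T) :
    p ^ 2 ∣ W.reductionPointCount ℓ := by
  have hp : p.Prime := Fact.out
  have hgood : W.HasGoodReductionAt v := (hasGoodReductionAtPrime_primesEquiv_iff_holds W v ℓ hvℓ).mp hgoodℓ
  have hpv : (p : 𝓞 ℚ) ∉ v.asIdeal := fun h ↦ hℓp (hvℓ.symm.trans (primesEquiv_eq_of_natCast_mem hp h))
  set k := IsLocalRing.ResidueField (v.adicCompletionIntegers ℚ) with hk
  set Wt : WeierstrassCurve k := W.reductionAt v with hWt
  haveI : Wt.IsElliptic := isElliptic_reductionAt hgood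
  have hWtk : Wt.baseChange k = Wt := by
    rw [baseChange, Algebra.algebraMap_self, WeierstrassCurve.map_id]
  have hcard : Nat.card (Wt.baseChange k).toAffine.Point = W.reductionPointCount ℓ := by
    rw [← hvℓ]; exact natCard_point_reduction_minimal_baseChange v W
  rw [hWtk] at hcard
  -- the local Frobenius and the reduction map on `W[p^∞]`
  obtain ⟨𝔐, h𝔐⟩ := v.localPrimesAbove_nonempty
  let ι : AlgebraicClosure ℚ →ₐ[ℚ] AlgebraicClosure (v.adicCompletion ℚ) :=
    closureEmb (K := ℚ) (v.adicCompletion ℚ)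
  obtain ⟨σL, hσL⟩ := v.exists_isArithFrobAt_localAbsIntegers h𝔐
  obtain ⟨φk, hφk⟩ := exists_frobenius_absoluteGaloisGroup k
  obtain ⟨f, hf, hfσ⟩ := exists_reduceTorsionHom hpv hgood h𝔐 ι hσL hφk
  have hσ₀fix : ∀ T : W.geomTorsion p, resGalOfEmb ι σL • T = T :=
    hfix _ (primeBelow_mem_primesAbove h𝔐) _ (isArithFrobAt_resGalOfEmb h𝔐 ι hσL)
  -- `W[p] ≤ W[p^∞]`, and the restriction `F` of the reduction map to `W[p]`
  have hle : W.geomTorsion p ≤ geomPrimaryTorsion W p := fun T hT ↦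
    ⟨1, by rw [pow_one]; exact AddSubgroup.torsionBy.nsmul_iff.mp hT⟩
  let F : W.geomTorsion p →+ geomPoints Wt := f.comp (AddSubgroup.inclusion hle)
  have hFinj : Function.Injective F := hf.comp (AddSubgroup.inclusion_injective hle)
  have hFfix : ∀ T : W.geomTorsion p, φk • F T = F T := by
    intro T
    have h1 := hfσ (AddSubgroup.inclusion hle T)
    have h2 : resGalOfEmb ι σL • AddSubgroup.inclusion hle T = AddSubgroup.inclusion hle T := by
      apply Subtype.ext
      rw [primaryComponent.coe_smul, AddSubgroup.coe_inclusion, ← AddSubgroup.torsionBy.coe_smul, hσ₀fix T]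
    rw [h2] at h1
    exact h1.symm
  have hFmem : ∀ T : W.geomTorsion p, F T ∈ (toGeomPoints Wt).range := fun T ↦
    mem_range_toGeomPoints_of_smul_eq hφk (hFfix T)
  have hcardp : Nat.card (W.geomTorsion p) = p ^ 2 :=
    card_torsionPoints_eq_sq_holds W (AlgebraicClosure ℚ) (Nat.cast_ne_zero.mpr hp.ne_zero)
  let G : W.geomTorsion p →+ (toGeomPoints Wt).range := F.codRestrict (toGeomPoints Wt).range hFmem
  have hGinj : Function.Injective G := fun a b hab ↦ hFinj (congrArg Subtype.val hab)
  have hdvd : Nat.card (W.geomTorsion p) ∣ Nat.card (toGeomPoints Wt).range :=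
    AddSubgroup.card_dvd_of_injective G hGinj
  have hrange : Nat.card (toGeomPoints Wt).range = Nat.card Wt.toAffine.Point :=
    (Nat.card_congr (AddMonoidHom.ofInjective (toGeomPoints_injective Wt)).toEquiv).symm
  rw [hcardp, hrange, hcard] at hdvd
  exact hdvd

/-! ### §4. THEOREM B — at `p = 5` the Frobenius at `11` fixes `μ₅`; Hasse at `11` -/

-- (LANDING NOTE, LEAD p1 g23: es's re-proof of `residueCard_dvd_of_natCast_mem` is dropped for the dedup rule; the tree's
-- `Literature.NumberTheory.Automorphic.Ash2003.residueCard_dvd_of_natCast_mem` is used by name.)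

/-- If `W` is good at the prime `ℓ ∤ N` whenever `f` of level `N` is its newform (Carayol `N = N_W`).
[cite: Carayol1986, Thm. (A)] [cite: SilvermanAEC2009, VII.5.1(a)] -/
theorem hasGoodReductionAtPrime_of_not_dvd_level {W : WeierstrassCurve ℚ} [W.IsElliptic] {N : ℕ} [NeZero N]
    {f : CuspForm (Gamma0 N) 2} (hf : IsNewformOf W f) (ℓ : ℕ) [hℓ : Fact ℓ.Prime] (hN : ¬ ℓ ∣ N) :
    W.HasGoodReductionAtPrime ℓ := by
  by_contra hbad
  exact hN ((hf.dvd_level_iff_dvd_conductorNorm hℓ.out).mpr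
    ((W.dvd_conductorNorm_iff_not_hasGoodReductionAtPrime ℓ).mpr hbad))

/-- **THEOREM B.**  If every `σ ∈ Γ_ℚ` fixing `μ₅` acts trivially on `W[5]` (`W/ℚ` globally minimal), then `W` has BAD reduction
at `11`: `Frob₁₁` fixes `μ₅` (`11 ≡ 1 (mod 5)`), so LEMMA R would give `25 ∣ #W̃(𝔽₁₁) = 12 − a₁₁ ∈ [6, 18]` (Hasse).
[cite: SilvermanAEC2009, V.1.1, VII.3.1(b)] [cite: Vatsal2005, Rem. 1.8] -/
theorem not_hasGoodReductionAtPrime_eleven_of_smul_eq (W : WeierstrassCurve ℚ) [W.IsElliptic] [W.IsGloballyMinimal]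
    (hfix : ∀ σ : Field.absoluteGaloisGroup ℚ, (∀ ζ : AlgebraicClosure ℚ, ζ ^ 5 = 1 → σ • ζ = ζ) →
      ∀ T : W.geomTorsion 5, σ • T = T) :
    ¬ W.HasGoodReductionAtPrime 11 := by
  intro hgood
  haveI h5 : Fact (Nat.Prime 5) := ⟨by norm_num⟩
  haveI h11 : Fact (Nat.Prime 11) := ⟨by norm_num⟩
  set v : HeightOneSpectrum (𝓞 ℚ) := (Rat.HeightOneSpectrum.primesEquiv (R := 𝓞 ℚ)).symm ⟨11, h11.out⟩ with hvdef
  have hv : ((11 : ℕ) : 𝓞 ℚ) ∈ v.asIdeal := (natCast_mem_asIdeal_iff_eq_primesEquiv_symm v h11.out).mpr hvdef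
  have hvℓ : (Rat.HeightOneSpectrum.primesEquiv v : ℕ) = 11 := primesEquiv_eq_of_natCast_mem h11.out hv
  have h5v : ((5 : ℕ) : 𝓞 ℚ) ∉ v.asIdeal := fun h ↦ by
    have h' := primesEquiv_eq_of_natCast_mem h5.out h
    omega
  have hres : v.residueCard = 11 :=
    ((Nat.dvd_prime h11.out).mp (Literature.NumberTheory.Automorphic.Ash2003.residueCard_dvd_of_natCast_mem hv)).resolve_left (one_lt_residueCard v).ne'
  have h25 : 5 ^ 2 ∣ W.reductionPointCount 11 := by
    refine sq_dvd_reductionPointCount_of_frobenius_smul_eq W (by norm_num) hgood hvℓ fun 𝔓 h𝔓 φ hφ T ↦ hfix φ ?_ T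
    intro ζ hζ
    rw [smul_eq_pow_residueCard_of_isArithFrobAt h5v h𝔓 hφ (n := 1) (by rw [pow_one]; exact hζ), hres,
      show (11 : ℕ) = 5 * 2 + 1 by norm_num, pow_succ, pow_mul, hζ, one_pow, one_mul]
  have hH : W.frobeniusTrace 11 ^ 2 ≤ 4 * 11 := W.frobeniusTrace_sq_le_four_mul 11 hgood
  have hsub := frobeniusTrace_sub_eq_neg_reductionPointCount W 11
  norm_num at h25
  obtain ⟨m, hm⟩ := h25
  rw [hm] at hsub
  push_cast at hsub
  have h1 : W.frobeniusTrace 11 ≤ 6 := by nlinarith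
  have h2 : -6 ≤ W.frobeniusTrace 11 := by nlinarith
  omega

/-! ### §5. The assembly: `5 ∣ [Λ₀(f) : Λ₁(f)] ⟹ 11 ∣ N` -/

/-- **`5 ∣ [Λ₀(f) : Λ₁(f)]` forces `11 ∣ N`** for a lattice-optimal `X₀(N)`-datum of a globally minimal elliptic `W₀/ℚ`
(UNCONDITIONAL: the flat Stevens twin, F★ and cusp lifting are tree theorems).  Row E-es-221 `ElevenDividesLevelOfShimuraFive`.
[cite: Vatsal2005, Rem. 1.8] [cite: LingOesterle1991, §1 Cor. 1] [cite: Stevens1989, §2] [cite: Manin1972, Thm. 1.9]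
[cite: SilvermanAEC2009, III.8.1, V.1.1, VII.3.1(b)] -/
theorem eleven_dvd_level_of_not_shimuraIndexPrimeTo_five
    (W₀ : WeierstrassCurve ℚ) [W₀.IsElliptic] [W₀.IsGloballyMinimal] {N : ℕ} [NeZero N]
    (D₀ : ModularParametrizationData W₀ N)
    (hopt : ∀ z ∈ D₀.L.lattice, ∃ w ∈ periodLattice D₀.f, z = D₀.c * w)
    (hS : ¬ ShimuraIndexPrimeTo 5 D₀.f) : 11 ∣ N := by
  haveI : Fact (Nat.Prime 11) := ⟨by norm_num⟩
  have h5 : Nat.Prime 5 := by norm_num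
  have hS' := hS
  simp only [ShimuraIndexPrimeTo, not_forall, exists_prop] at hS'
  obtain ⟨x, hx, h5x, hx₁⟩ := hS'
  -- the flat Stevens twin, with rational Shimura-cover kernel (F★)
  obtain ⟨W₁, hW₁, D₁, hf, -, hopt₁, -, -⟩ := CuspValues.exists_optimal_gamma1ParametrizationData_flat_of_datum D₀
  haveI := hW₁
  have hF := CuspValues.optimalGamma1Parametrization_cusp_rational_holds
  have hrat : ∀ y ∈ periodLattice D₀.f, ∃ P : (W₁.baseChange ℚ).toAffine.Point,
      Affine.Point.baseChange (W' := W₁) ℚ ℂ P = D₁.uniformize ((D₁.c : ℂ) * y) := fun y hy ↦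
    exists_rational_eq_uniformize_of_mem_periodLattice hF D₁ hopt₁ (by rwa [hf])
  have hx' : x ∈ periodLattice D₁.f := by rwa [hf]
  have h5x' : ((5 : ℕ) : ℂ) * x ∈ periodLatticeGamma1 D₁.f := by rw [hf]; exact_mod_cast h5x
  have hx₁' : x ∉ periodLatticeGamma1 D₁.f := by rwa [hf]
  obtain ⟨P, hP, hP5⟩ := exists_addOrderOf_eq_of_mem_periodLattice hF D₁ hopt₁ h5 hx' h5x' hx₁'
  -- a rational point of order `5` on `W₀` (cusp lifting)
  obtain ⟨t, ht⟩ := CuspLifting.exists_addOrderOf_eq_prime D₀ hopt h5 hS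
  have hfix : ∀ σ : Field.absoluteGaloisGroup ℚ, (∀ ζ : AlgebraicClosure ℚ, ζ ^ 5 = 1 → σ • ζ = ζ) →
      ∀ T : W₀.geomTorsion 5, σ • T = T := fun σ hσ T ↦
    smul_eq_self_of_shimuraCover W₀ W₁ D₀ D₁ hf hopt hopt₁ hrat h5 (by norm_num) hx hP hP5 (t := t) ht σ hσ T
  by_contra h11
  exact not_hasGoodReductionAtPrime_eleven_of_smul_eq W₀ hfix
    (hasGoodReductionAtPrime_of_not_dvd_level D₀.isNewformOf 11 h11)

/-! ### §6. Corollaries: `ShimuraIndexPrimeTo 5` off `11 ∣ N`; `a₂ = −2`; the prime-level Derickx–Orlić law -/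

/-- Off `11 ∣ N` the Shimura index of a lattice-optimal datum of a minimal curve is prime to `5`. [cite: Vatsal2005, Rem. 1.8] -/
theorem shimuraIndexPrimeTo_five_of_not_eleven_dvd
    (W₀ : WeierstrassCurve ℚ) [W₀.IsElliptic] [W₀.IsGloballyMinimal] {N : ℕ} [NeZero N]
    (D₀ : ModularParametrizationData W₀ N)
    (hopt : ∀ z ∈ D₀.L.lattice, ∃ w ∈ periodLattice D₀.f, z = D₀.c * w) (h11 : ¬ 11 ∣ N) :
    ShimuraIndexPrimeTo 5 D₀.f := by
  by_contra hS
  exact h11 (eleven_dvd_level_of_not_shimuraIndexPrimeTo_five W₀ D₀ hopt hS)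

/-- **`a₂ = −2` at odd level `11 ∤ N` forces `Λ₀(f) = Λ₁(f)`** (lattice-optimal datum of a minimal curve): the Eisenstein
congruence at `2` gives `(a₂ − 3)Λ₀ = −5Λ₀ ⊆ Λ₁` (`ShimuraIndexAtTwo.oddLevelEisensteinAtTwo`) and `5 ∤ [Λ₀ : Λ₁]`.
[cite: LingOesterle1991, Thm. 6] [cite: Vatsal2005, Rem. 1.8] -/
theorem periodLattice_le_gamma1_of_frobeniusTrace_two_eq_neg_two
    (W₀ : WeierstrassCurve ℚ) [W₀.IsElliptic] [W₀.IsGloballyMinimal] {N : ℕ} [NeZero N]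
    (D₀ : ModularParametrizationData W₀ N)
    (hopt : ∀ z ∈ D₀.L.lattice, ∃ w ∈ periodLattice D₀.f, z = D₀.c * w) (hN2 : ¬ 2 ∣ N) (hN11 : ¬ 11 ∣ N)
    (ha : W₀.frobeniusTrace 2 = -2) : ∀ z ∈ periodLattice D₀.f, z ∈ periodLatticeGamma1 D₀.f := by
  intro z hz
  obtain ⟨-, hmem⟩ := ShimuraIndexAtTwo.oddLevelEisensteinAtTwo W₀ D₀.f D₀.isNewformOf hN2
  have h5z : ((5 : ℕ) : ℂ) * z ∈ periodLatticeGamma1 D₀.f := by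
    have h' := (periodLatticeGamma1 D₀.f).neg_mem (hmem z hz)
    rw [ha] at h'
    convert h' using 1
    push_cast
    ring
  exact shimuraIndexPrimeTo_five_of_not_eleven_dvd W₀ D₀ hopt hN11 z hz h5z

/-- **THE DERICKX–ORLIĆ EXPONENT LAW AT EVERY PRIME LEVEL `q ∉ {11, 17}`** (lattice-optimal data of globally minimal curves):
`2Λ₀(f) ⊆ Λ₁(f) ∨ 3Λ₀(f) ⊆ Λ₁(f)` — `ShimuraPrimeLevelAtTwo.two_mul_mem_or_three_mul_mem_primeLevel_of_frobeniusTrace_two_ne`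
off `a₂ = −2`, and `Λ₀ = Λ₁` at `a₂ = −2` by the preceding corollary.  Both excluded levels are genuine exceptions
(11a1: `Λ₀/Λ₁ ≅ ℤ/5`; 17a1: `ℤ/4`). [cite: DerickxOrlic2025, Rmk. 4.8] [cite: LingOesterle1991, Thm. 1, Thm. 6] [cite: Setzer1975, Thm. 2] -/
theorem two_mul_mem_or_three_mul_mem_primeLevel_of_ne
    (W : WeierstrassCurve ℚ) [W.IsElliptic] [W.IsGloballyMinimal] {q : ℕ} [NeZero q]
    (D : ModularParametrizationData W q)
    (hopt : ∀ z ∈ D.L.lattice, ∃ w ∈ periodLattice D.f, z = D.c * w) (hq : q.Prime) (h11 : q ≠ 11) (h17 : q ≠ 17) :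
    (∀ z ∈ periodLattice D.f, 2 * z ∈ periodLatticeGamma1 D.f) ∨ (∀ z ∈ periodLattice D.f, 3 * z ∈ periodLatticeGamma1 D.f) := by
  by_cases ha : W.frobeniusTrace 2 = -2
  · refine Or.inl fun z hz ↦ ?_
    have h11' : ¬ 11 ∣ q := fun h ↦ h11 ((Nat.prime_dvd_prime_iff_eq (by norm_num) hq).mp h).symm
    have h := periodLattice_le_gamma1_of_frobeniusTrace_two_eq_neg_two W D hopt
      (ShimuraPrimeLevelAtTwo.not_two_dvd_of_prime_level D hq) h11' ha z hz
    rw [two_mul]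
    exact add_mem h h
  · exact ShimuraPrimeLevelAtTwo.two_mul_mem_or_three_mul_mem_primeLevel_of_frobeniusTrace_two_ne D hopt hq h17 ha


end Summit.BirchSwinnertonDyer.BirchSwinnertonDyer.Theorems.ManinLocalTwoThree.ShimuraFive

end
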